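import Mathlib
import Summits.NavierStokesRegularity.NavierStokesRegularity.Theorems.EulerZoomLiouvillePowerGaugeEulerLiouvilleSelfSimilarEndpointSmooth
import Literature.Analysis.FluidPDE.LipschitzSqIntegrableDecay
import HarnessLib.Audit

/-!
# Rung C1 of the crux `EulerZoomLiouville.PowerGaugeEulerLiouville` at the endpoint `ρ = 1/2`:
# the classical stratum for profiles with BOUNDED HESSIAN (no decay hypothesis on the gradient)

Route №10 `EulerZoomLiouville` (NavierStokesRegularity), crux E = stmt-NavierStokesRegularity-19832,
registered stub `stub_selfSimilarEndpointClassical` (skeleton v10, line `birth`).  Sequel to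
`…SelfSimilarEndpointSmooth` (`Kelvin.selfSimilar_half_ae_eq_zero_of_smoothProfile`: smooth bounded
profile with bounded gradient TENDING TO ZERO at infinity ⇒ trivial).  Here the decay hypothesis
`DV → 0` is DERIVED from a bound on the Hessian:

* `tendsto_fderiv_cocompact_of_lipschitzWith` — **Landau's interpolation at infinity**: if
  `V → 0` along the cocompact filter and `DV` is Lipschitz then `DV → 0` along the cocompact
  filter (second-order Taylor estimate on the segment `[x − re, x + re]`:
  `2r‖DV(x)e‖ ≤ ‖V(x+re)‖ + ‖V(x−re)‖ + 2Lr²`);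
* `selfSimilar_half_ae_eq_zero_of_boundedHessian` — **the classical endpoint stratum for
  `W^{2,∞}` profiles**: crux hypotheses VERBATIM at `ρ = 1/2` + exact self-similarity + classical
  profile with `V ∈ C^∞`, `‖V‖ ≤ M`, `‖DV‖ ≤ K`, `DV` Lipschitz ⇒ `u = 0` a.e. (`V ∈ L²` by the
  `A`-gauge and `V` Lipschitz give `V → 0`, tree `tendsto_cocompact_of_lipschitzWith_of_integrable_sq`;
  then Landau gives `DV → 0`, and `…EndpointSmooth` applies).  This is Chae–Wolf 2020 Cor. 1.5 in
  the self-similar case for `W^{2,∞}` profiles (they need only `W^{1,∞}`), unconditional.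

WHAT THIS IS NOT: not NS, not E, not the stub `stub_selfSimilarExtremalRest` (weak-class endpoint,
sub-critical window).

## References

* D. Chae, J. Wolf, Comm. Math. Phys. 376 (2020) = arXiv:1706.02020, Cor. 1.5. [ChaeWolf2020EulerTypeI]
* P. Constantin, M. Ignatova, V. Vicol, arXiv:2602.17570 (2026), §3.4.2. [ConstantinIgnatovaVicol2026Putative]
-/

noncomputable section

-- flat `Theorems/<Route><Decl>…` files of one crux share the namespace of the crux (tree convention)
set_option linter.dupNamespace false

open MeasureTheory Set Filter Topology Metric Function InnerProductSpace
open scoped RealInnerProductSpace NNReal ENNReal ContDiff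

namespace Summit.NavierStokesRegularity.NavierStokesRegularity.Theorems.PowerGaugeEulerLiouville.Kelvin

open Literature.Analysis Literature.Analysis.FluidPDE

variable {V : EuclideanSpace ℝ (Fin 3) → EuclideanSpace ℝ (Fin 3)}

/-- **Landau's interpolation at infinity**: `V → 0` along the cocompact filter and `DV` Lipschitz
⇒ `DV → 0` along the cocompact filter. [folklore] -/
theorem tendsto_fderiv_cocompact_of_lipschitzWith (hV : Differentiable ℝ V) {L : ℝ≥0}
    (hL : LipschitzWith L (fderiv ℝ V))
    (h0 : Tendsto V (cocompact (EuclideanSpace ℝ (Fin 3))) (𝓝 0)) :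
    Tendsto (fderiv ℝ V) (cocompact (EuclideanSpace ℝ (Fin 3))) (𝓝 0) := by
  rw [tendsto_cocompact_nhds_zero_iff_norm] at h0 ⊢
  intro ε hε
  set L' : ℝ := (L : ℝ) + 1 with hL'
  have hL'0 : 0 < L' := by positivity
  set r : ℝ := ε / (4 * L') with hr
  have hr0 : 0 < r := by positivity
  set δ : ℝ := r * ε / 8 with hδ
  have hδ0 : 0 < δ := by positivity
  obtain ⟨A, hA⟩ := h0 δ hδ0
  refine ⟨A + r, fun x hx => ?_⟩
  by_contra hnot
  push Not at hnot
  obtain ⟨e, he1, he⟩ := (fderiv ℝ V x).exists_lt_apply_of_lt_opNorm hnot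
  -- the second-order Taylor estimate on the segment `t ∈ [−r, r]`
  set g : ℝ → EuclideanSpace ℝ (Fin 3) := fun t => V (x + t • e) - t • fderiv ℝ V x e with hg
  have hg' : ∀ t, HasDerivAt g (fderiv ℝ V (x + t • e) e - fderiv ℝ V x e) t := by
    intro t
    have h1 : HasDerivAt (fun t : ℝ => x + t • e) e t := by
      simpa using ((hasDerivAt_id t).smul_const e).const_add x
    have h2 := (hV (x + t • e)).hasFDerivAt.comp_hasDerivAt t h1
    have h3 : HasDerivAt (fun t : ℝ => t • fderiv ℝ V x e) (fderiv ℝ V x e) t := by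
      simpa using (hasDerivAt_id t).smul_const (fderiv ℝ V x e)
    exact h2.sub h3
  have hbound : ∀ t ∈ Ico (-r) r, ‖fderiv ℝ V (x + t • e) e - fderiv ℝ V x e‖ ≤ L * r := by
    intro t ht
    have h1 : ‖fderiv ℝ V (x + t • e) - fderiv ℝ V x‖ ≤ L * ‖x + t • e - x‖ := hL.norm_sub_le _ _
    rw [add_sub_cancel_left, norm_smul, Real.norm_eq_abs] at h1
    have ht' : |t| ≤ r := abs_le.2 ⟨ht.1, ht.2.le⟩
    calc ‖fderiv ℝ V (x + t • e) e - fderiv ℝ V x e‖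
        = ‖(fderiv ℝ V (x + t • e) - fderiv ℝ V x) e‖ := by simp
      _ ≤ ‖fderiv ℝ V (x + t • e) - fderiv ℝ V x‖ * ‖e‖ := ContinuousLinearMap.le_opNorm _ _
      _ ≤ L * (|t| * ‖e‖) * ‖e‖ := mul_le_mul_of_nonneg_right h1 (norm_nonneg _)
      _ ≤ L * r := by
          have h5 : |t| * ‖e‖ ≤ r * 1 := mul_le_mul ht' he1.le (norm_nonneg _) hr0.le
          have h6 : |t| * ‖e‖ * ‖e‖ ≤ r * 1 * 1 :=
            mul_le_mul h5 he1.le (norm_nonneg _) (by positivity)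
          have h7 : |t| * ‖e‖ * ‖e‖ ≤ r := by simpa using h6
          rw [mul_assoc]
          exact mul_le_mul_of_nonneg_left h7 (NNReal.coe_nonneg L)
  have hseg := norm_image_sub_le_of_norm_deriv_le_segment' (f := g) (a := -r) (b := r)
    (fun t _ => (hg' t).hasDerivWithinAt) hbound r (right_mem_Icc.2 (by linarith))
  -- `g r − g (−r) = V(x+re) − V(x−re) − 2r DV(x)e`
  have hgr : g r - g (-r) = (V (x + r • e) - V (x + (-r) • e)) - (2 * r) • fderiv ℝ V x e := by
    simp only [hg]; module
  rw [hgr] at hseg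
  -- both endpoints are far out
  have hfar : ∀ s : ℝ, |s| ≤ r → A ≤ ‖x + s • e‖ := by
    intro s hs
    have h1 : ‖x‖ ≤ ‖x + s • e‖ + ‖s • e‖ := by
      have := norm_sub_le (x + s • e) (s • e); simpa using this
    have h2 : ‖s • e‖ ≤ r := by
      rw [norm_smul, Real.norm_eq_abs]; nlinarith [abs_nonneg s, norm_nonneg e]
    linarith
  have hV1 : ‖V (x + r • e)‖ ≤ δ := hA _ (hfar r (by rw [abs_of_pos hr0]))
  have hV2 : ‖V (x + (-r) • e)‖ ≤ δ := hA _ (hfar (-r) (by rw [abs_neg, abs_of_pos hr0]))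
  -- `2r ε < 2r ‖DV x e‖ ≤ 2δ + 2Lr²`
  have hkey : (2 * r) * ‖fderiv ℝ V x e‖ ≤ δ + δ + L * r * (r - -r) := by
    have h1 : ‖(2 * r) • fderiv ℝ V x e‖ ≤ ‖V (x + r • e) - V (x + (-r) • e)‖ +
        ‖(V (x + r • e) - V (x + (-r) • e)) - (2 * r) • fderiv ℝ V x e‖ := by
      have := norm_sub_le (V (x + r • e) - V (x + (-r) • e))
        ((V (x + r • e) - V (x + (-r) • e)) - (2 * r) • fderiv ℝ V x e)
      simpa using this
    rw [norm_smul, Real.norm_eq_abs, abs_of_pos (by positivity)] at h1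
    linarith [norm_sub_le (V (x + r • e)) (V (x + (-r) • e))]
  have h3 : (2 * r) * ε < (2 * r) * ‖fderiv ℝ V x e‖ := mul_lt_mul_of_pos_left he (by positivity)
  -- contradiction with the choice of `r` and `δ`
  have h4 : L * r ≤ ε / 4 := by
    rw [hr]
    have : (L : ℝ) ≤ L' := by linarith
    calc (L : ℝ) * (ε / (4 * L')) ≤ L' * (ε / (4 * L')) :=
          mul_le_mul_of_nonneg_right this (by positivity)
      _ = ε / 4 := by field_simp
  nlinarith [hkey, h3, h4, hr0, hε]

/-- **The classical endpoint stratum for `W^{2,∞}` profiles** (no decay hypothesis on `DV`):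
crux hypotheses at `ρ = 1/2` + exact self-similarity + classical profile with `V` smooth,
`‖V‖ ≤ M`, `‖DV‖ ≤ K` and `DV` Lipschitz ⇒ `u = 0` a.e. on the slab.
[cite: ChaeWolf2020EulerTypeI, Cor. 1.5; ConstantinIgnatovaVicol2026Putative, §3.4.2 Remark 3.6] -/
theorem selfSimilar_half_ae_eq_zero_of_boundedHessian
    {u : ℝ → EuclideanSpace ℝ (Fin 3) → EuclideanSpace ℝ (Fin 3)}
    {p : ℝ → EuclideanSpace ℝ (Fin 3) → ℝ}
    {H : ℝ → EuclideanSpace ℝ (Fin 3) → EuclideanSpace ℝ (Fin 3) →L[ℝ] EuclideanSpace ℝ (Fin 3)}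
    {c : ℝ≥0} {P : EuclideanSpace ℝ (Fin 3) → ℝ}
    (hsw : IsSuitableWeakSolutionOn (slab (EuclideanSpace ℝ (Fin 3)) (Iio 0) isOpen_Iio) 0 0 u p)
    (hH : HasWeakSpatialGradientOn (slab (EuclideanSpace ℝ (Fin 3)) (Iio 0) isOpen_Iio) u H)
    (hgauge : ∀ a : ℝ, 0 < a →
      ENNReal.ofReal (a ^ (2 * (1 / 2 : ℝ))) * cknA a (0 : ℝ × EuclideanSpace ℝ (Fin 3)) u +
          ENNReal.ofReal (a ^ (1 / 2 : ℝ)) * cknE a (0 : ℝ × EuclideanSpace ℝ (Fin 3)) H +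
        ENNReal.ofReal (a ^ (2 * (1 / 2 : ℝ))) * cknD a (0 : ℝ × EuclideanSpace ℝ (Fin 3)) p ≤
          (c : ℝ≥0∞))
    (hu : ∀ τ : ℝ, τ < 0 → u τ = selfSimilarCollapse (1 / (2 + (1 / 2 : ℝ))) 0 V τ)
    (hp : ∀ τ : ℝ, τ < 0 → p τ = selfSimilarCollapsePressure (1 / (2 + (1 / 2 : ℝ))) 0 P τ)
    (hprof : IsSelfSimilarEulerProfile (1 / (2 + (1 / 2 : ℝ))) 0 V P)
    (hV : ContDiff ℝ ∞ V) {M : ℝ} (hM : ∀ y, ‖V y‖ ≤ M) {K : ℝ} (hK : ∀ y, ‖fderiv ℝ V y‖ ≤ K)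
    {L : ℝ≥0} (hL : LipschitzWith L (fderiv ℝ V)) :
    uncurry u =ᵐ[volume.restrict (Iio (0 : ℝ) ×ˢ (univ : Set (EuclideanSpace ℝ (Fin 3))))] 0 := by
  -- `V ∈ L²` from the `A`-gauge
  have hA : ∀ a : ℝ, 0 < a → ENNReal.ofReal (a ^ (2 * (1 / 2 : ℝ))) *
      cknA a (0 : ℝ × EuclideanSpace ℝ (Fin 3)) u ≤ (c : ℝ≥0∞) :=
    fun a ha => le_trans (le_trans le_self_add le_self_add) (hgauge a ha)
  have hum : AEStronglyMeasurable (uncurry u)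
      (volume.restrict (Iio (0 : ℝ) ×ˢ (univ : Set (EuclideanSpace ℝ (Fin 3))))) := by
    have := hH.locallyIntegrableOn.aestronglyMeasurable
    simpa [slab] using this
  have hVm := aestronglyMeasurable_profile hum hu
  have hV2 : Integrable (fun y => ‖V y‖ ^ 2) volume :=
    integrable_norm_sq_of_lintegral_lt_top hVm
      (lt_of_le_of_lt (lintegral_enorm_sq_profile_le_of_half hu hA) ENNReal.coe_lt_top)
  -- `V` is Lipschitz, hence `V → 0` at infinity; Landau gives `DV → 0`
  have hVd : Differentiable ℝ V := hV.differentiable (by simp)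
  have hK0 : 0 ≤ K := (norm_nonneg _).trans (hK 0)
  have hLipV : LipschitzWith ⟨K, hK0⟩ V :=
    lipschitzWith_of_nnnorm_fderiv_le hVd fun y => by
      have h := hK y
      exact_mod_cast h
  have h0 := tendsto_cocompact_of_lipschitzWith_of_integrable_sq hLipV hV2
  have hDV := tendsto_fderiv_cocompact_of_lipschitzWith hVd hL h0
  exact selfSimilar_half_ae_eq_zero_of_smoothProfile hsw hH hgauge hu hp hprof hV hM hK hDV

end Summit.NavierStokesRegularity.NavierStokesRegularity.Theorems.PowerGaugeEulerLiouville.Kelvin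

end
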